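import Mathlib
import Literature.MeasureTheory.Integral.PowerWeightedLineIntegral

/-!
# Crux `HyperoctahedralRP.HRP2Rigidity` — stub S7 `stub_mellinAxialSymmetry`

Line `xray-mellin-transfer` of crux stmt-CriticalPhenomena-1979, step S7: **Mellin uniqueness in the
probe exponent ⇒ axial symmetry about every lattice axis ⇒ `O(3)`-invariance.**

RUNNING LOG (worker): all parts below are proved in this file; nothing is left open.

Statement.  `K : ℝ³ → ℝ` is continuous and positive off `0`, homogeneous of degree `-β < 0`,
invariant under the nine lattice mirrors, and for every probe exponent `δ` with `0 < δ`,
`1 - β < δ < 1` the probed axial X-rays `y ↦ ∫ K (y + s eᵢ) |s|^{-δ} ds` are radial on `eᵢ^⊥ ∖ 0`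
for each axis `i`.  Then `K (R x) = K x` for every linear isometry `R` of `ℝ³`.

Proof.
1. *Slices.*  For `v ⊥ e`, `v ≠ 0`, `‖e‖ = 1` the slice `f_v (t) := K (v + t e)` is continuous,
   even (coordinate mirror `θ_e`), bounded by `M ‖v‖^{-β}` and by `M t^{-β}` (envelope
   `|K x| ≤ M ‖x‖^{-β}` of a homogeneous kernel, `‖v + t e‖² = ‖v‖² + t²`).  Hence its Mellin
   transform converges and is holomorphic on the strip `0 < re z < β`
   (`mellin_differentiableAt_of_isBigO_rpow`), and by evenness
   `∫ f_v (s) |s|^{-δ} ds = 2 · mellin f_v (1 - δ)` (`integral_comp_abs`, no convergence needed).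
2. *Identity theorem.*  The hypothesis gives `mellin f_v = mellin f_w` at the real points of
   `(0, min 1 β)`; both sides are holomorphic on the (convex, open) strip, so they agree on the
   strip (`AnalyticOnNhd.eqOn_of_preconnected_of_frequently_eq`), in particular on the vertical
   line `re z = min 1 β / 2`.
3. *Mellin uniqueness on a line.*  If `mellin f = mellin g` on a vertical line of common
   convergence then `f = g` on `(0, ∞)` (apply Mathlib's Mellin inversion `mellinInv_mellin_eq` to
   `f - g`, whose transform vanishes on the line and is therefore vertically integrable).  So
   `f_v = f_w` on `(0, ∞)`, on `[0, ∞)` by continuity, on `ℝ` by evenness.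
4. *Geometry.*  Axial symmetry about `e₂` moves `x = y + x₂ e₂` (`y ⊥ e₂`) to
   `‖y‖ e₁ + x₂ e₂ ∈ e₀^⊥`, and radiality on the plane `e₀^⊥` moves it to `‖x‖ e₂`; so
   `K x = K (‖x‖ e₂)` for `x ≠ 0`, and isometries preserve the norm.

References: Mathlib `Mathlib/Analysis/MellinTransform.lean`, `Mathlib/Analysis/MellinInversion.lean`;
the tree's `Literature.MeasureTheory.Integral.PowerWeightedLineIntegral` (envelope, Pythagoras and
continuity along probing lines).  All steps are standard analysis [folklore].
-/

noncomputable section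

open MeasureTheory Set Filter Asymptotics Complex
open scoped Topology InnerProductSpace Real

namespace Summit.CriticalPhenomena.Ising3DConformalLimit.Cruxes.HRP2Rigidity.XRayMellin

open Literature.MeasureTheory.Integral

/-! ### Generic Mellin-transform facts -/

/-- **Mellin uniqueness on a vertical line.**  If `f, g : (0,∞) → ℂ` are continuous, their Mellin
transforms converge on the line `re z = σ` and agree there, then `f = g` on `(0, ∞)` (Mellin
inversion applied to `f - g`, whose transform vanishes on the line). [folklore] -/
theorem eqOn_of_mellin_eq_on_line {f g : ℝ → ℂ} {σ : ℝ}
    (hf : ∀ y : ℝ, MellinConvergent f (σ + y * I)) (hg : ∀ y : ℝ, MellinConvergent g (σ + y * I))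
    (hfc : ContinuousOn f (Ioi 0)) (hgc : ContinuousOn g (Ioi 0))
    (h : ∀ y : ℝ, mellin f (σ + y * I) = mellin g (σ + y * I)) : EqOn f g (Ioi 0) := by
  intro x hx
  have h0 : ((σ : ℂ) + ((0 : ℝ) : ℂ) * I) = σ := by simp
  have hconv : MellinConvergent (fun t => f t - g t) σ := by
    have h1 := (hasMellin_sub (hf 0) (hg 0)).1
    rwa [h0] at h1
  have hzero : ∀ y : ℝ, mellin (fun t => f t - g t) (σ + y * I) = 0 := fun y => by
    rw [(hasMellin_sub (hf y) (hg y)).2, h y, sub_self]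
  have hVI : Complex.VerticalIntegrable (mellin fun t => f t - g t) σ := by
    unfold Complex.VerticalIntegrable
    simp_rw [hzero]
    exact integrable_zero _ _ _
  have hcont : ContinuousAt (fun t => f t - g t) x :=
    (hfc.sub hgc).continuousAt (Ioi_mem_nhds hx)
  have key := mellinInv_mellin_eq σ (fun t => f t - g t) hx hconv hVI hcont
  simp only [mellinInv, hzero, smul_zero, integral_zero] at key
  exact sub_eq_zero.1 key.symm

/-- **Identity theorem on a vertical strip.**  Two functions holomorphic on the open strip
`b < re z < a` which agree at the real points of an interval `(c, d) ⊆ (b, a)` agree on the whole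
strip. [folklore] -/
theorem eqOn_strip_of_eq_ofReal {F G : ℂ → ℂ} {a b c d : ℝ} (hcd : c < d) (hbc : b ≤ c)
    (hda : d ≤ a)
    (hF : DifferentiableOn ℂ F ({z : ℂ | b < z.re} ∩ {z : ℂ | z.re < a}))
    (hG : DifferentiableOn ℂ G ({z : ℂ | b < z.re} ∩ {z : ℂ | z.re < a}))
    (h : ∀ x : ℝ, c < x → x < d → F x = G x) :
    EqOn F G ({z : ℂ | b < z.re} ∩ {z : ℂ | z.re < a}) := by
  have hU : IsOpen ({z : ℂ | b < z.re} ∩ {z : ℂ | z.re < a}) :=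
    (isOpen_lt continuous_const Complex.continuous_re).inter
      (isOpen_lt Complex.continuous_re continuous_const)
  have hUc : IsPreconnected ({z : ℂ | b < z.re} ∩ {z : ℂ | z.re < a}) :=
    ((convex_halfSpace_re_gt b).inter (convex_halfSpace_re_lt a)).isPreconnected
  have hx₀ : (((c + d) / 2 : ℝ) : ℂ) ∈ ({z : ℂ | b < z.re} ∩ {z : ℂ | z.re < a}) := by
    constructor
    · show b < (((c + d) / 2 : ℝ) : ℂ).re
      rw [ofReal_re]; linarith
    · show (((c + d) / 2 : ℝ) : ℂ).re < a
      rw [ofReal_re]; linarith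
  have h3 : Tendsto ((↑) : ℝ → ℂ) (𝓝[≠] ((c + d) / 2)) (𝓝[≠] (((c + d) / 2 : ℝ) : ℂ)) := by
    rw [tendsto_nhdsWithin_iff]; constructor
    · exact tendsto_nhdsWithin_of_tendsto_nhds continuous_ofReal.continuousAt
    · refine eventually_nhdsWithin_iff.mpr (Eventually.of_forall fun t ht => ?_)
      rw [mem_compl_iff, mem_singleton_iff] at ht ⊢
      exact fun h' => ht (ofReal_injective h')
  refine (hF.analyticOnNhd hU).eqOn_of_preconnected_of_frequently_eq (hG.analyticOnNhd hU) hUc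
    hx₀ (h3.frequently ?_)
  refine ((Eventually.filter_mono nhdsWithin_le_nhds) ?_).frequently
  have hI : Ioo c d ∈ 𝓝 ((c + d) / 2) := Ioo_mem_nhds (by linarith) (by linarith)
  exact Filter.mem_of_superset hI fun x hx => h x hx.1 hx.2

/-- An even weight against the Riesz probe: `∫_ℝ f(s) |s|^{-δ} ds = 2 ∫_{(0,∞)} f(t) t^{-δ} dt` for
even `f` (no convergence hypothesis: both sides vanish together). [folklore] -/
theorem integral_mul_abs_rpow_of_even {f : ℝ → ℝ} (hf : ∀ t, f (-t) = f t) (δ : ℝ) :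
    ∫ s : ℝ, f s * |s| ^ (-δ) = 2 * ∫ t in Ioi (0:ℝ), f t * t ^ (-δ) := by
  have habs : ∀ s : ℝ, f |s| = f s := fun s => by
    rcases le_or_gt 0 s with h | h
    · rw [abs_of_nonneg h]
    · rw [abs_of_neg h, hf]
  have key : (fun s : ℝ => f s * |s| ^ (-δ)) = fun s => f |s| * |s| ^ (-δ) := by
    funext s; rw [habs]
  rw [key]
  exact integral_comp_abs (f := fun u => f u * u ^ (-δ))

/-- The Mellin transform of a real function at a real point is the real Mellin integral.
[folklore] -/
theorem mellin_ofReal_ofReal (f : ℝ → ℝ) (x : ℝ) :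
    mellin (fun t => (f t : ℂ)) (x : ℂ) = ((∫ t in Ioi (0:ℝ), f t * t ^ (x - 1) : ℝ) : ℂ) := by
  rw [mellin, ← integral_complex_ofReal]
  refine setIntegral_congr_fun measurableSet_Ioi fun t ht => ?_
  have h1 : ((x : ℂ) - 1) = ((x - 1 : ℝ) : ℂ) := by push_cast; ring
  rw [h1, ← ofReal_cpow (le_of_lt ht), smul_eq_mul]
  push_cast
  ring

/-! ### Slices of a kernel along a probing line -/

variable {E : Type*} [NormedAddCommGroup E] [InnerProductSpace ℝ E]

/-- Envelope of the slice `t ↦ K (v + t e)` (`v ⊥ e`, `v ≠ 0`): it is bounded by `M ‖v‖^{-β}`,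
and by `M t^{-β}` for `t > 0`. [folklore] -/
theorem abs_slice_le {K : E → ℝ} {β M : ℝ} {e v : E} (he : ‖e‖ = 1) (hve : ⟪v, e⟫_ℝ = 0)
    (hv : v ≠ 0) (hβ : 0 ≤ β) (hM : 0 ≤ M) (hKM : ∀ x, x ≠ 0 → |K x| ≤ M * ‖x‖ ^ (-β))
    (t : ℝ) :
    |K (v + t • e)| ≤ M * ‖v‖ ^ (-β) ∧ (0 < t → |K (v + t • e)| ≤ M * t ^ (-β)) := by
  have hne := add_smul_ne_zero_of_inner_eq_zero he hve hv t
  have hsq := norm_add_smul_sq_of_inner_eq_zero he hve t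
  have hn0 : 0 ≤ ‖v + t • e‖ := norm_nonneg _
  have hr : 0 < ‖v‖ := norm_pos_iff.2 hv
  have hv1 : ‖v‖ ≤ ‖v + t • e‖ := by
    have : ‖v‖ ^ 2 ≤ ‖v + t • e‖ ^ 2 := by rw [hsq]; nlinarith [sq_nonneg t]
    exact (pow_le_pow_iff_left₀ hr.le hn0 two_ne_zero).1 this
  have hKx := hKM _ hne
  refine ⟨hKx.trans (mul_le_mul_of_nonneg_left
    (Real.rpow_le_rpow_of_nonpos hr hv1 (by linarith)) hM), fun ht => ?_⟩
  have hv2 : t ≤ ‖v + t • e‖ := by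
    have : t ^ 2 ≤ ‖v + t • e‖ ^ 2 := by rw [hsq]; nlinarith [norm_nonneg v]
    exact (pow_le_pow_iff_left₀ ht.le hn0 two_ne_zero).1 this
  exact hKx.trans (mul_le_mul_of_nonneg_left
    (Real.rpow_le_rpow_of_nonpos ht hv2 (by linarith)) hM)

/-- The analytic input for Mellin: the (complexified) slice is locally integrable on `(0, ∞)`,
`O(t^{-β})` at `+∞` and `O(1)` at `0⁺`. [folklore] -/
theorem slice_mellin_data {K : E → ℝ} {β M : ℝ} {e v : E} (he : ‖e‖ = 1) (hve : ⟪v, e⟫_ℝ = 0)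
    (hv : v ≠ 0) (hβ : 0 ≤ β) (hM : 0 ≤ M) (hK : ContinuousOn K {0}ᶜ)
    (hKM : ∀ x, x ≠ 0 → |K x| ≤ M * ‖x‖ ^ (-β)) :
    LocallyIntegrableOn (fun t : ℝ => ((K (v + t • e) : ℝ) : ℂ)) (Ioi 0) ∧
    (fun t : ℝ => ((K (v + t • e) : ℝ) : ℂ)) =O[atTop] (fun t : ℝ => t ^ (-β)) ∧
    (fun t : ℝ => ((K (v + t • e) : ℝ) : ℂ)) =O[𝓝[>] 0] (fun t : ℝ => t ^ (-(0:ℝ))) := by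
  have hc : Continuous fun t : ℝ => ((K (v + t • e) : ℝ) : ℂ) :=
    continuous_ofReal.comp (continuous_comp_add_smul hK he hve hv)
  refine ⟨hc.continuousOn.locallyIntegrableOn measurableSet_Ioi, ?_, ?_⟩
  · refine IsBigO.of_bound M ((eventually_gt_atTop 0).mono fun t ht => ?_)
    rw [Complex.norm_real, Real.norm_eq_abs, Real.norm_of_nonneg (Real.rpow_nonneg ht.le _)]
    exact (abs_slice_le he hve hv hβ hM hKM t).2 ht
  · refine IsBigO.of_bound (M * ‖v‖ ^ (-β)) (Eventually.of_forall fun t => ?_)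
    rw [Complex.norm_real, Real.norm_eq_abs, neg_zero, Real.rpow_zero, norm_one, mul_one]
    exact (abs_slice_le he hve hv hβ hM hKM t).1

/-- **Mellin uniqueness in the probe exponent.**  If two even slices `K (v + · e)`, `K (w + · e)`
(`v, w ⊥ e` nonzero) of a kernel with envelope `M ‖x‖^{-β}`, `β > 0`, have the same Riesz probes
`∫ K (· + s e) |s|^{-δ} ds` for all `δ ∈ (max 0 (1-β), 1)`, they coincide. [folklore] -/
theorem slice_eq_of_probe_eq {K : E → ℝ} {β M : ℝ} {e v w : E} (he : ‖e‖ = 1)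
    (hve : ⟪v, e⟫_ℝ = 0) (hwe : ⟪w, e⟫_ℝ = 0) (hv : v ≠ 0) (hw : w ≠ 0) (hβ : 0 < β)
    (hM : 0 ≤ M) (hK : ContinuousOn K {0}ᶜ) (hKM : ∀ x, x ≠ 0 → |K x| ≤ M * ‖x‖ ^ (-β))
    (hev : ∀ t : ℝ, K (v + (-t) • e) = K (v + t • e))
    (hew : ∀ t : ℝ, K (w + (-t) • e) = K (w + t • e))
    (hX : ∀ δ : ℝ, 0 < δ → 1 - β < δ → δ < 1 →
      ∫ s : ℝ, K (v + s • e) * |s| ^ (-δ) = ∫ s : ℝ, K (w + s • e) * |s| ^ (-δ)) (t : ℝ) :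
    K (v + t • e) = K (w + t • e) := by
  set F : ℝ → ℂ := fun t => ((K (v + t • e) : ℝ) : ℂ) with hF
  set G : ℝ → ℂ := fun t => ((K (w + t • e) : ℝ) : ℂ) with hG
  obtain ⟨hF1, hF2, hF3⟩ := slice_mellin_data he hve hv hβ.le hM hK hKM
  obtain ⟨hG1, hG2, hG3⟩ := slice_mellin_data he hwe hw hβ.le hM hK hKM
  -- Step 1: the Mellin transforms agree at the real points of `(0, min 1 β)`
  have hreal : ∀ x : ℝ, 0 < x → x < min 1 β → mellin F x = mellin G x := by
    intro x hx0 hx1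
    have hx1' : x < 1 := hx1.trans_le (min_le_left _ _)
    have hxβ : x < β := hx1.trans_le (min_le_right _ _)
    have h1 := hX (1 - x) (by linarith) (by linarith) (by linarith)
    rw [integral_mul_abs_rpow_of_even (f := fun s => K (v + s • e)) hev,
      integral_mul_abs_rpow_of_even (f := fun s => K (w + s • e)) hew] at h1
    have h2 : ∫ t in Ioi (0:ℝ), K (v + t • e) * t ^ (-(1 - x)) =
        ∫ t in Ioi (0:ℝ), K (w + t • e) * t ^ (-(1 - x)) := by linarith
    rw [hF, hG, mellin_ofReal_ofReal, mellin_ofReal_ofReal, show x - 1 = -(1 - x) by ring, h2]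
  -- Step 2: identity theorem on the strip `0 < re z < β`
  have hstrip : EqOn (mellin F) (mellin G) ({z : ℂ | 0 < z.re} ∩ {z : ℂ | z.re < β}) :=
    eqOn_strip_of_eq_ofReal (lt_min one_pos hβ) le_rfl (min_le_right 1 β)
      (fun z hz => (mellin_differentiableAt_of_isBigO_rpow hF1 hF2 hz.2 hF3
        hz.1).differentiableWithinAt)
      (fun z hz => (mellin_differentiableAt_of_isBigO_rpow hG1 hG2 hz.2 hG3
        hz.1).differentiableWithinAt)
      hreal
  -- Step 3: Mellin uniqueness on the line `re z = min 1 β / 2`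
  have hσ0 : 0 < min 1 β / 2 := by positivity
  have hσβ : min 1 β / 2 < β := by
    have := min_le_right 1 β
    linarith [lt_min one_pos hβ]
  have hre : ∀ y : ℝ, (((min 1 β / 2 : ℝ) : ℂ) + y * I).re = min 1 β / 2 := fun y => by simp
  have hmem : ∀ y : ℝ, (((min 1 β / 2 : ℝ) : ℂ) + y * I) ∈
      ({z : ℂ | 0 < z.re} ∩ {z : ℂ | z.re < β}) := fun y =>
    ⟨by show 0 < (((min 1 β / 2 : ℝ) : ℂ) + y * I).re; rw [hre]; exact hσ0,
     by show (((min 1 β / 2 : ℝ) : ℂ) + y * I).re < β; rw [hre]; exact hσβ⟩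
  have hline : EqOn F G (Ioi 0) :=
    eqOn_of_mellin_eq_on_line
      (fun y => mellinConvergent_of_isBigO_rpow hF1 hF2 (by rw [hre]; exact hσβ) hF3
        (by rw [hre]; exact hσ0))
      (fun y => mellinConvergent_of_isBigO_rpow hG1 hG2 (by rw [hre]; exact hσβ) hG3
        (by rw [hre]; exact hσ0))
      (continuous_ofReal.comp (continuous_comp_add_smul hK he hve hv)).continuousOn
      (continuous_ofReal.comp (continuous_comp_add_smul hK he hwe hw)).continuousOn
      (fun y => hstrip (hmem y))
  -- Step 4: back to the real slices: `t > 0`, then `t ≥ 0` by continuity, then `t < 0` by evenness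
  have hpos : EqOn (fun t : ℝ => K (v + t • e)) (fun t => K (w + t • e)) (Ioi 0) := by
    intro s hs
    have h1 := hline hs
    simp only [hF, hG, ofReal_inj] at h1
    exact h1
  have hnn := hpos.closure (continuous_comp_add_smul hK he hve hv)
    (continuous_comp_add_smul hK he hwe hw)
  rw [closure_Ioi] at hnn
  rcases le_or_gt 0 t with ht | ht
  · exact hnn ht
  · have h1 : K (v + (-t) • e) = K (w + (-t) • e) := hnn (show (0:ℝ) ≤ -t by linarith)
    rwa [hev, hew] at h1

/-! ### The stub -/

/-- Registered stub `stub_mellinAxialSymmetry` — **S7 · Mellin uniqueness in the probe exponent,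
and generation of `O(3)`.**  If `K` is continuous positive off `0`, homogeneous of degree `-β < 0`,
nine-mirror invariant, and for every `δ` with `0 < δ`, `1 - β < δ < 1` the probed X-rays
`∫ K(y + s eᵢ)|s|^{-δ} ds` are radial about every axis, then `K` is `O(3)`-invariant: the even,
continuous, `O(s^{-β})` slices `s ↦ K(ŷ + s eᵢ)` have holomorphic Mellin transforms on
`0 < re z < β` with `∫ K(ŷ + s eᵢ)|s|^{-δ} ds = 2 · mellin (1 - δ)`; equality on the real
interval propagates by the identity theorem and Mellin inversion on a vertical line identifies the
slices (`slice_eq_of_probe_eq`); two axes then generate: `K (x₀,x₁,x₂) = K (0, √(x₀²+x₁²), x₂) =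
K (0, 0, ‖x‖)`. [folklore] -/
theorem stub_mellinAxialSymmetry :
    ∀ (β : ℝ) (K : EuclideanSpace ℝ (Fin 3) → ℝ), 0 < β →
      ContinuousOn K {0}ᶜ → (∀ x, x ≠ 0 → 0 < K x) →
      (∀ c : ℝ, 0 < c → ∀ x, K (c • x) = c ^ (-β) * K x) →
      (∀ n : EuclideanSpace ℝ (Fin 3), (∃ i j : Fin 3, i ≠ j ∧ (n = EuclideanSpace.single i 1 ∨ n = EuclideanSpace.single i 1 + EuclideanSpace.single j 1 ∨
        n = EuclideanSpace.single i 1 - EuclideanSpace.single j 1)) →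
        ∀ x, K (((ℝ ∙ n)ᗮ).reflection x) = K x) →
      (∀ δ : ℝ, 0 < δ → 1 - β < δ → δ < 1 →
        ∀ (i : Fin 3) (y y' : EuclideanSpace ℝ (Fin 3)), inner ℝ y (EuclideanSpace.single i (1:ℝ)) = 0 →
          inner ℝ y' (EuclideanSpace.single i (1:ℝ)) = 0 → y ≠ 0 → ‖y‖ = ‖y'‖ →
          ∫ s : ℝ, K (y + s • EuclideanSpace.single i (1:ℝ)) * |s| ^ (-δ) =
            ∫ s : ℝ, K (y' + s • EuclideanSpace.single i (1:ℝ)) * |s| ^ (-δ)) →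
      ∀ (R : EuclideanSpace ℝ (Fin 3) ≃ₗᵢ[ℝ] EuclideanSpace ℝ (Fin 3)) (x : EuclideanSpace ℝ (Fin 3)), K (R x) = K x := by
  intro β K hβ hKc _hKp hhom hmir hX R x
  -- the envelope `|K x| ≤ M ‖x‖^{-β}`
  obtain ⟨M, hM0, hKM⟩ := exists_bound_of_continuousOn_of_homogeneous hKc hhom
  -- the coordinate axes
  set e : Fin 3 → EuclideanSpace ℝ (Fin 3) := fun i => EuclideanSpace.single i (1:ℝ) with he_def
  have he : ∀ i : Fin 3, ‖e i‖ = 1 := fun i => by simp [e]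
  have hin : ∀ (u : EuclideanSpace ℝ (Fin 3)) (i : Fin 3), ⟪u, e i⟫_ℝ = u i := fun u i => by
    simp [e, EuclideanSpace.inner_single_right]
  -- evenness of the slices from the coordinate mirrors
  have heven : ∀ (i : Fin 3) (y : EuclideanSpace ℝ (Fin 3)), ⟪y, e i⟫_ℝ = 0 →
      ∀ t : ℝ, K (y + (-t) • e i) = K (y + t • e i) := by
    intro i y hy t
    obtain ⟨j, hij⟩ : ∃ j : Fin 3, i ≠ j := by
      fin_cases i
      exacts [⟨1, by decide⟩, ⟨0, by decide⟩, ⟨0, by decide⟩]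
    have h := hmir (e i) ⟨i, j, hij, Or.inl rfl⟩ (y + t • e i)
    rw [← h, map_add, map_smul, Submodule.reflection_mem_subspace_eq_self
      (Submodule.mem_orthogonal_singleton_iff_inner_left.2 hy),
      Submodule.reflection_orthogonalComplement_singleton_eq_neg, smul_neg, neg_smul]
  -- axial symmetry about each axis (Mellin uniqueness in the probe exponent)
  have hax : ∀ (i : Fin 3) (y y' : EuclideanSpace ℝ (Fin 3)), ⟪y, e i⟫_ℝ = 0 → ⟪y', e i⟫_ℝ = 0 →
      y ≠ 0 → ‖y‖ = ‖y'‖ → ∀ t : ℝ, K (y + t • e i) = K (y' + t • e i) := by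
    intro i y y' hy hy' hy0 hn t
    have hy0' : y' ≠ 0 := by
      rw [← norm_ne_zero_iff, ← hn]; exact norm_ne_zero_iff.2 hy0
    exact slice_eq_of_probe_eq (he i) hy hy' hy0 hy0' hβ hM0 hKc hKM (heven i y hy)
      (heven i y' hy') (fun δ h0 h1 h2 => hX δ h0 h1 h2 i y y' hy hy' hy0 hn) t
  -- `K` is a function of the norm: `K x = K (‖x‖ e₂)` for `x ≠ 0`
  have hrad : ∀ x : EuclideanSpace ℝ (Fin 3), x ≠ 0 → K x = K (‖x‖ • e 2) := by
    intro x hx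
    have hxn : 0 < ‖x‖ := norm_pos_iff.2 hx
    have h02 : ⟪‖x‖ • e 2, e 0⟫_ℝ = 0 := by rw [inner_smul_left, hin]; simp [e]
    set y : EuclideanSpace ℝ (Fin 3) := x - x 2 • e 2 with hy_def
    have hy2 : ⟪y, e 2⟫_ℝ = 0 := by rw [hin]; simp [y, e]
    have hxy : y + x 2 • e 2 = x := sub_add_cancel x _
    by_cases hy0 : y = 0
    · -- `x` lies on the axis `e₂ ⊂ e₀^⊥`: radiality on the plane `e₀^⊥`
      have hx2 : x = x 2 • e 2 := by
        have h := hxy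
        rw [hy0, zero_add] at h
        exact h.symm
      have h1 : ⟪x, e 0⟫_ℝ = 0 := by rw [hx2, inner_smul_left, hin]; simp [e]
      have h3 : ‖x‖ = ‖‖x‖ • e 2‖ := by rw [norm_smul, norm_norm, he, mul_one]
      have h4 := hax 0 x (‖x‖ • e 2) h1 h02 hx h3 0
      simpa using h4
    · -- move `x` into the plane `e₀^⊥` by the axial symmetry about `e₂`, then use radiality there
      set q : EuclideanSpace ℝ (Fin 3) := ‖y‖ • e 1 + x 2 • e 2 with hq_def
      have hy1e : ⟪‖y‖ • e 1, e 2⟫_ℝ = 0 := by rw [inner_smul_left, hin]; simp [e]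
      have hny : ‖y‖ = ‖‖y‖ • e 1‖ := by rw [norm_smul, norm_norm, he, mul_one]
      have step1 : K x = K q := by
        have h4 := hax 2 y (‖y‖ • e 1) hy2 hy1e hy0 hny (x 2)
        rwa [hxy] at h4
      have hq0 : ⟪q, e 0⟫_ℝ = 0 := by
        rw [hq_def, inner_add_left, inner_smul_left, inner_smul_left, hin, hin]; simp [e]
      have hqn : ‖q‖ = ‖x‖ := by
        have h1 : ‖q‖ ^ 2 = ‖y‖ ^ 2 + (x 2) ^ 2 := by
          rw [hq_def, norm_add_smul_sq_of_inner_eq_zero (he 2) hy1e, ← hny]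
        have h2 : ‖x‖ ^ 2 = ‖y‖ ^ 2 + (x 2) ^ 2 := by
          have h := norm_add_smul_sq_of_inner_eq_zero (he 2) hy2 (x 2)
          rwa [hxy] at h
        nlinarith [norm_nonneg q, norm_nonneg x]
      have hq : q ≠ 0 := by rw [← norm_ne_zero_iff, hqn]; exact hxn.ne'
      have h3 : ‖q‖ = ‖‖x‖ • e 2‖ := by rw [norm_smul, norm_norm, he, mul_one, hqn]
      have h4 := hax 0 q (‖x‖ • e 2) hq0 h02 hq h3 0
      rw [step1]
      simpa using h4
  -- conclusion: isometries preserve the norm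
  by_cases hx : x = 0
  · simp [hx]
  · have hRx : R x ≠ 0 := by simpa using hx
    rw [hrad _ hRx, hrad _ hx, LinearIsometryEquiv.norm_map]

end Summit.CriticalPhenomena.Ising3DConformalLimit.Cruxes.HRP2Rigidity.XRayMellin
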